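import Summits.QuantumFields.YangMills.Theorems.BalabanUVNodesN16CentreConventionAllDepths
import HarnessLib

/-!
# YM-DAG node N16 (NE3), the located averaging pin (42) ↔ (0.4) — part 19: WILSON AND POLYAKOV LOOPS DETERMINE THE GAUGE ORBIT — the lattice
# reconstruction theorem on the torus, and the CHARACTERISATION of part 14's (defect) clause by based torus-closed Wilson loops of the two `k`-fold averages

Cell `pub-ymgap`, width seat `pub-ymgap-dag-n16-w3` (director-ym №197 ∕ HUMAN RULING D-0149), generation 7; part 19 of the W1b lineage (part 14 p616704
`SchemeGaugeEquiv`; part 16 p622848; part 18 `…N16SchemeGaugeInvariants`: equivalent schemes have conjugate closed Wilson loops — the NECESSARY condition).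
`--kind proof --supports stmt-QuantumFields-20544 --as helper` (K3⁷; count-neutral; 0 `def`).  `bears_on: R4∕N16`.

THE POINT.  Part 18 showed: pointwise coarse-gauge equivalence ⇒ all closed Wilson loops of the two averages are conjugate.  This file proves the CONVERSE, i.e. the
lattice reconstruction theorem ([folklore]; the lattice form of «holonomies determine the connection up to gauge»), for configurations on `ℤᵈ` with values in ANY
group `G` and b07's parallel transport `hol` ([Balaban1985Averaging] (9)):
 * §1 `hol_eq_of_shift_invariant` (translation-invariant configurations have translation-invariant transports, b07∕lit `hol_shift`), `hol_bondLoop` (the based loop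
   «tree path to `x`, the bond `⟨x, x+e_μ⟩`, tree path back from `x+e_μ`» has transport `P(x)·V(x,μ)·P(x+e_μ)⁻¹`, `P = axialFn V x₀` = b07's axial transporter),
   `hol_polyakovLoop` (for `N`-PERIODIC `V`: «tree path to `x`, `N` steps in direction `i`, the SAME tree path back» — closed on the torus `(ℤ∕N)ᵈ` — has transport
   `P(x)·V(x; N e_i)·P(x)⁻¹`).
 * §2 ★★★ `eq_gaugeAct_of_hol_conj` — RECONSTRUCTION: if ALL closed Wilson loops based at `x₀` satisfy `B(Γ) = c·A(Γ)·c⁻¹` for one group element `c`, then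
   `B = A^{κ}` EXACTLY with the EXPLICIT gauge `κ(x) = P_B(x)⁻¹·c·P_A(x)` (`κ(x₀) = c`); ★★ `periodic_reconGauge_of_hol_conj` — if moreover `A, B` are `N`-periodic
   and the based POLYAKOV-type words (net displacement `N e_i`) are `c`-conjugate too, then `κ` is `N`-PERIODIC; `reconGauge_mem` — `κ` takes values in any subgroup
   containing the values of `A`, `B` and `c` (so: unitary data ⇒ unitary gauge); converse `hol_conj_of_eq_gaugeAct` ∕ `hol_conj_of_eq_gaugeAct_polyakov` (b07
   `hol_gaugeAct`).
 * §3 (`G = U(N) ⊂ M_N(ℂ)ˣ`, the tree's `IsUnitarySite ∕ IsPeriodicSite ∕ IsUnitaryCfg ∕ IsPeriodicCfg`): ★★ `exists_unitary_periodic_gauge_iff_hol_conj` — for unitary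
   `N`-periodic `A, B`: (∃ unitary `N`-periodic `κ`, `B = A^{κ}`) ⟺ (∃ unitary `c`, all based closed AND Polyakov-type Wilson loops are `c`-conjugate); hence ★★
   `schemeGaugeEquiv_iff_hol_conj` — part 14's `SchemeGaugeEquiv d s₁ s₂ L N k C` is EQUIVALENT to: (cov₁) ∧ (cov₂) ∧ «for every `U ∈ C` one unitary `c_U` conjugates
   every based torus-closed Wilson loop of `avgIterS s₂ k U` into that of `avgIterS s₁ k U`», whenever both `k`-fold averages of class members are unitary and
   `N`-periodic.  With part 18 this makes the criterion road for the (42) ↔ (0.4) pin a statement about WILSON LOOPS OF THE TWO AVERAGES ONLY: the pin's (defect)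
   clause holds iff the (0.4)- and (42)-type `k`-fold averages of every small field have simultaneously-conjugate based loop holonomies.
HONEST FRAMING.  [folklore] lattice gauge bookkeeping BY NAME over b07's `hol ∕ hol_append ∕ hol_revWord' ∕ hol_gaugeAct ∕ axialFn ∕ treeWord` and lit's `hol_shift`;
0 `def` (the reconstructed gauge is DISPLAYED: `fun x => (axialFn B x₀ x)⁻¹ * c * axialFn A x₀ x`), 0 `sorry`; no configuration, minimiser or witness constructed;
nothing of [Balaban1985Averaging] asserted; K3⁷ stubs NOT touched; N16 ∕ NE3 NOT discharged; count-neutral (typed 28∕28 · discharged 5∕27 work-bound, A 5∕28 —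
unmoved).  One finite four-torus programme at fixed `ε` — the Yang–Mills mass gap (Clay) is NOT proved by any of this; R4 closes the conditional finite-𝕋⁴ rung
`BalabanLadder.UV` only; nothing continuum ∕ ℝ⁴ ∕ OS.
-/

set_option autoImplicit false

open scoped BigOperators Matrix Matrix.Norms.L2Operator
open NormedSpace

namespace Summit.QuantumFields.YangMills.BalabanUVNodes.N16WilsonLoopsGaugeOrbit

open Literature.MathematicalPhysics.QuantumFieldTheory.Balaban1983to89
open B7Prop1Explicit B7Prop2Explicit
open T4TermwiseTorus (hol_shift)
open T4AveragingDeficitWall (IsUnitaryCfg)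
open T4AveragingDeficitWallBoundary (IsPeriodicCfg)
open Summit.QuantumFields.BalabanUV.T4Continuum
open NE3EnergyShapes (IsUnitarySite IsPeriodicSite)
open Summit.QuantumFields.YangMills.BalabanUVNodes.N16AveragingPin (avgIterS)
open Summit.QuantumFields.YangMills.BalabanUVNodes.N16CentreConventionTransfer (SchemeGaugeEquiv)

noncomputable section

/-! ## §1 Transports of translation-invariant configurations; the bond loop and the Polyakov-type loop -/

section Transport

variable {d : ℕ} {G : Type*} [Group G]

/-- A configuration invariant under the translation `y ↦ y + v` has translation-invariant transports: `V(Γ + v) = V(Γ)` (lit's `hol_shift`). [folklore] -/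
theorem hol_eq_of_shift_invariant (V : Site d → Fin d → G) (v : Site d) (hV : ∀ (y : Site d) (μ : Fin d), V (y + v) μ = V y μ)
    (x : Site d) (w : List (Letter d)) : hol V (x + v) w = hol V x w := by
  have h : (fun y κ => V (y + v) κ) = V := funext fun y => funext fun κ => hV y κ
  rw [← hol_shift V v x w, h]

/-- **THE BOND LOOP**: the based word «tree path `Γ_{x₀,x}`, the bond `⟨x, x + e_μ⟩`, the tree path `Γ_{x₀,x+e_μ}` reversed» is CLOSED and has transport
`P(x)·V(x,μ)·P(x+e_μ)⁻¹`, `P = axialFn V x₀` (b07's axial transporter `V(Γ_{x₀,x})`). [folklore] -/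
theorem disp_bondLoop (x₀ x : Site d) (μ : Fin d) :
    disp (treeWord (x - x₀) ++ [((μ, true) : Letter d)] ++ revWord (treeWord (x + e μ - x₀))) = 0 := by
  simp only [disp_append, disp_treeWord, disp_cons, disp_nil, Letter.vec_true, disp_revWord, add_zero]
  abel

/-- The transport of the bond loop. [folklore] -/
theorem hol_bondLoop (V : Site d → Fin d → G) (x₀ x : Site d) (μ : Fin d) :
    hol V x₀ (treeWord (x - x₀) ++ [((μ, true) : Letter d)] ++ revWord (treeWord (x + e μ - x₀)))
      = axialFn V x₀ x * V x μ * (axialFn V x₀ (x + e μ))⁻¹ := by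
  rw [hol_append, hol_append, disp_append, disp_treeWord, hol_cons, hol_nil, mul_one, stepHol_true,
    show x₀ + (x - x₀) = x by abel, disp_cons, disp_nil, add_zero, Letter.vec_true,
    hol_revWord' V (x := x₀) (x₀ + (x - x₀ + e μ)) (treeWord (x + e μ - x₀)) (by rw [disp_treeWord]; abel)]
  rfl

/-- **THE POLYAKOV-TYPE LOOP**: the based word «`Γ_{x₀,x}`, `N` steps in direction `i`, `Γ_{x₀,x}` reversed» has net displacement `N e_i` (closed on the torus
`(ℤ∕N)ᵈ`, not on `ℤᵈ`). [folklore] -/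
theorem disp_polyakovLoop (x₀ x : Site d) (i : Fin d) (N : ℕ) :
    disp (treeWord (x - x₀) ++ seg i (N : ℤ) ++ revWord (treeWord (x - x₀))) = (N : ℤ) • e i := by
  simp only [disp_append, disp_treeWord, disp_seg, disp_revWord]
  abel

/-- Its transport for a configuration invariant under `y ↦ y + N e_i`: `P(x)·V(x; N e_i)·P(x)⁻¹` (the way back is the translate of the way out). [folklore] -/
theorem hol_polyakovLoop (V : Site d → Fin d → G) (x₀ x : Site d) (i : Fin d) (N : ℕ)
    (hV : ∀ (y : Site d) (μ : Fin d), V (y + (N : ℤ) • e i) μ = V y μ) :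
    hol V x₀ (treeWord (x - x₀) ++ seg i (N : ℤ) ++ revWord (treeWord (x - x₀)))
      = axialFn V x₀ x * hol V x (seg i (N : ℤ)) * (axialFn V x₀ x)⁻¹ := by
  rw [hol_append, hol_append, disp_append, disp_treeWord, disp_seg, show x₀ + (x - x₀) = x by abel,
    show x₀ + (x - x₀ + (N : ℤ) • e i) = x + (N : ℤ) • e i by abel, hol_eq_of_shift_invariant V _ hV,
    hol_revWord' V (x := x₀) x (treeWord (x - x₀)) (by rw [disp_treeWord]; abel)]
  rfl

end Transport

/-! ## §2 The reconstruction theorem: conjugate based loops ⇒ an explicit gauge; periodic data + Polyakov loops ⇒ a periodic gauge -/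

section Reconstruction

variable {d : ℕ} {G : Type*} [Group G]

/-- **★★★ WILSON LOOPS DETERMINE THE GAUGE ORBIT (lattice reconstruction).**  If every CLOSED word `Γ` based at `x₀` has `B(Γ) = c·A(Γ)·c⁻¹` for one `c ∈ G`, then
`B = A^{κ}` EXACTLY (b07's `gaugeAct`: `A^{κ}(x,μ) = κ(x)·A(x,μ)·κ(x+e_μ)⁻¹`) for the EXPLICIT gauge `κ(x) = P_B(x)⁻¹·c·P_A(x)`, `P_V = axialFn V x₀` — the bond loops
of §1 are the only loops used. [folklore] -/
theorem eq_gaugeAct_of_hol_conj (A B : Site d → Fin d → G) (x₀ : Site d) (c : G)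
    (h0 : ∀ w : List (Letter d), disp w = 0 → hol B x₀ w = c * hol A x₀ w * c⁻¹) :
    B = gaugeAct (fun x => (axialFn B x₀ x)⁻¹ * c * axialFn A x₀ x) A := by
  funext x μ
  -- `P_B(x) B P_B(x+e_μ)⁻¹ = c P_A(x) A P_A(x+e_μ)⁻¹ c⁻¹`
  have hloop := h0 _ (disp_bondLoop x₀ x μ)
  rw [hol_bondLoop, hol_bondLoop] at hloop
  have hB : B x μ = (axialFn B x₀ x)⁻¹ * (axialFn B x₀ x * B x μ * (axialFn B x₀ (x + e μ))⁻¹) * axialFn B x₀ (x + e μ) := by group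
  rw [hB, hloop]
  simp only [gaugeAct]
  group

/-- The reconstructed gauge takes the value `c` at the base point (`Γ_{x₀,x₀}` is the empty word). [folklore] -/
theorem reconGauge_base (A B : Site d → Fin d → G) (x₀ : Site d) (c : G) :
    (fun x => (axialFn B x₀ x)⁻¹ * c * axialFn A x₀ x) x₀ = c := by
  simp [axialFn]

/-- The reconstructed gauge takes values in any subgroup containing the values of `A`, `B` and `c` (e.g. `U(N)`: unitary data ⇒ unitary gauge). [folklore] -/
theorem reconGauge_mem (S : Subgroup G) {A B : Site d → Fin d → G} (hA : ∀ x μ, A x μ ∈ S) (hB : ∀ x μ, B x μ ∈ S) (x₀ : Site d) {c : G} (hc : c ∈ S)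
    (x : Site d) : (axialFn B x₀ x)⁻¹ * c * axialFn A x₀ x ∈ S :=
  S.mul_mem (S.mul_mem (S.inv_mem (hol_mem_of hB _ _)) hc) (hol_mem_of hA _ _)

/-- **★★ PERIODIC DATA AND CONJUGATE POLYAKOV LOOPS ⇒ A PERIODIC GAUGE.**  If `A, B` are invariant under `y ↦ y + N e_i`, all based closed loops are `c`-conjugate
AND the based Polyakov-type words of §1 (net displacement `N e_i`) are `c`-conjugate, then the reconstructed gauge is invariant under `x ↦ x + N e_i`: the
Polyakov loop at `x` read through `B = A^{κ}` gives `κ(x)·A(x;Ne_i)·κ(x+Ne_i)⁻¹ = κ(x)·A(x;Ne_i)·κ(x)⁻¹`. [folklore] -/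
theorem periodic_reconGauge_of_hol_conj (A B : Site d → Fin d → G) (x₀ : Site d) (c : G) (N : ℕ) (i : Fin d)
    (hA : ∀ (y : Site d) (μ : Fin d), A (y + (N : ℤ) • e i) μ = A y μ) (hB : ∀ (y : Site d) (μ : Fin d), B (y + (N : ℤ) • e i) μ = B y μ)
    (h0 : ∀ w : List (Letter d), disp w = 0 → hol B x₀ w = c * hol A x₀ w * c⁻¹)
    (hT : ∀ w : List (Letter d), disp w = (N : ℤ) • e i → hol B x₀ w = c * hol A x₀ w * c⁻¹) (x : Site d) :
    (fun x => (axialFn B x₀ x)⁻¹ * c * axialFn A x₀ x) (x + (N : ℤ) • e i) = (fun x => (axialFn B x₀ x)⁻¹ * c * axialFn A x₀ x) x := by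
  set κ : Site d → G := fun x => (axialFn B x₀ x)⁻¹ * c * axialFn A x₀ x with hκ
  have hrec : B = gaugeAct κ A := eq_gaugeAct_of_hol_conj A B x₀ c h0
  -- the Polyakov loop at `x`, read twice
  have hP := hT _ (disp_polyakovLoop x₀ x i N)
  rw [hol_polyakovLoop B x₀ x i N hB, hol_polyakovLoop A x₀ x i N hA] at hP
  -- `B(x; N e_i) = κ x · A(x; N e_i) · κ(x + N e_i)⁻¹` from the reconstruction
  have hseg : hol B x (seg i (N : ℤ)) = κ x * hol A x (seg i (N : ℤ)) * (κ (x + (N : ℤ) • e i))⁻¹ := by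
    rw [hrec, hol_gaugeAct, disp_seg]
  -- and `= κ x · A(x; N e_i) · (κ x)⁻¹` from the conjugate Polyakov loops
  have hseg' : hol B x (seg i (N : ℤ)) = κ x * hol A x (seg i (N : ℤ)) * (κ x)⁻¹ := by
    have e1 : hol B x (seg i (N : ℤ)) = (axialFn B x₀ x)⁻¹ * (axialFn B x₀ x * hol B x (seg i (N : ℤ)) * (axialFn B x₀ x)⁻¹) * axialFn B x₀ x := by
      group
    rw [e1, hP, hκ]
    group
  have hcancel : (κ (x + (N : ℤ) • e i))⁻¹ = (κ x)⁻¹ := by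
    have := hseg.symm.trans hseg'
    exact mul_left_cancel this
  exact inv_injective hcancel

/-- **CONVERSE (b07's (8) along contours)**: a gauge transform `B = A^{κ}` has `c = κ(x₀)`-conjugate based closed loops … [cite: Balaban1985Averaging, (8) p.18] -/
theorem hol_conj_of_eq_gaugeAct (A : Site d → Fin d → G) (κ : Site d → G) (x₀ : Site d) (w : List (Letter d)) (hw : disp w = 0) :
    hol (gaugeAct κ A) x₀ w = κ x₀ * hol A x₀ w * (κ x₀)⁻¹ :=
  hol_gaugeAct_closed κ A x₀ w hw

/-- … and `κ(x₀)`-conjugate based Polyakov-type words when `κ` is invariant under `x ↦ x + N e_i`. [cite: Balaban1985Averaging, (8) p.18] -/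
theorem hol_conj_of_eq_gaugeAct_polyakov (A : Site d → Fin d → G) (κ : Site d → G) (x₀ : Site d) {N : ℕ} {i : Fin d}
    (hκ : ∀ x : Site d, κ (x + (N : ℤ) • e i) = κ x) (w : List (Letter d)) (hw : disp w = (N : ℤ) • e i) :
    hol (gaugeAct κ A) x₀ w = κ x₀ * hol A x₀ w * (κ x₀)⁻¹ := by
  rw [hol_gaugeAct, hw, hκ]

end Reconstruction

/-! ## §3 `G = U(N)`: the orbit under unitary periodic gauges is read off the based torus-closed Wilson loops; characterisation of part 14's (defect) clause -/

section Unitary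

variable {d : ℕ} {n : Type*} [Fintype n] [DecidableEq n]

/-- **★★ UNITARY PERIODIC GAUGE EQUIVALENCE ⟺ CONJUGATE BASED TORUS-CLOSED WILSON LOOPS.**  For `U(N)`-valued `N`-periodic configurations `A, B` on `ℤᵈ` and a base
point `x₀`: there is a unitary `N`-periodic `κ` with `B = A^{κ}` iff there is a unitary `c` conjugating every based closed loop AND every based word of net
displacement `N e_i` (Polyakov-type) of `B` into that of `A`. [folklore] -/
theorem exists_unitary_periodic_gauge_iff_hol_conj {N : ℕ} {A B : Site d → Fin d → (Matrix n n ℂ)ˣ} (hA : IsUnitaryCfg A) (hAP : IsPeriodicCfg A (N : ℤ))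
    (hB : IsUnitaryCfg B) (hBP : IsPeriodicCfg B (N : ℤ)) (x₀ : Site d) :
    (∃ κ : Site d → (Matrix n n ℂ)ˣ, IsUnitarySite κ ∧ IsPeriodicSite κ (N : ℤ) ∧ B = gaugeAct κ A) ↔
      ∃ c : (Matrix n n ℂ)ˣ, c ∈ unitaryUnits (Matrix n n ℂ) ∧
        (∀ w : List (Letter d), disp w = 0 → hol B x₀ w = c * hol A x₀ w * c⁻¹) ∧
        (∀ (w : List (Letter d)) (i : Fin d), disp w = (N : ℤ) • e i → hol B x₀ w = c * hol A x₀ w * c⁻¹) := by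
  constructor
  · rintro ⟨κ, hκ, hκP, rfl⟩
    exact ⟨κ x₀, hκ x₀, fun w hw => hol_conj_of_eq_gaugeAct A κ x₀ w hw,
      fun w i hw => hol_conj_of_eq_gaugeAct_polyakov A κ x₀ (fun x => hκP x i) w hw⟩
  · rintro ⟨c, hc, h0, hT⟩
    refine ⟨fun x => (axialFn B x₀ x)⁻¹ * c * axialFn A x₀ x, fun x => reconGauge_mem (unitaryUnits (Matrix n n ℂ)) hA hB x₀ hc x,
      fun x i => periodic_reconGauge_of_hol_conj A B x₀ c N i (fun y μ => hAP y i μ) (fun y μ => hBP y i μ) h0 (fun w hw => hT w i hw) x,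
      eq_gaugeAct_of_hol_conj A B x₀ c h0⟩

variable {s₁ s₂ : ℕ → (Site d → Fin d → (Matrix n n ℂ)ˣ) → (Site d → Fin d → (Matrix n n ℂ)ˣ)} {L N k : ℕ}
  {C : Set (Site d → Fin d → (Matrix n n ℂ)ˣ)}

/-- **★★ PART 14's (defect) CLAUSE, READ OFF THE WILSON LOOPS OF THE TWO AVERAGES.**  If both `k`-fold averages of every `U ∈ C` are unitary and `N`-periodic
(true for the schemes in play on the small-field classes), then: pointwise coarse-gauge equivalence of the two averages on `C` ⟺ for every `U ∈ C` ONE unitary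
`c_U` conjugates every based closed loop and every based Polyakov-type word of `avgIterS s₂ k U` into that of `avgIterS s₁ k U` (base point `0`).  With part 18
(necessity of conjugate loops) and (cov₁)∕(cov₂) this makes `SchemeGaugeEquiv` a statement about WILSON LOOPS OF THE AVERAGES ONLY. [folklore] -/
theorem defect_iff_hol_conj
    (hu₁ : ∀ U ∈ C, IsUnitaryCfg (avgIterS s₁ k U)) (hP₁ : ∀ U ∈ C, IsPeriodicCfg (avgIterS s₁ k U) (N : ℤ))
    (hu₂ : ∀ U ∈ C, IsUnitaryCfg (avgIterS s₂ k U)) (hP₂ : ∀ U ∈ C, IsPeriodicCfg (avgIterS s₂ k U) (N : ℤ)) :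
    (∀ U ∈ C, ∃ κ : Site d → (Matrix n n ℂ)ˣ, IsUnitarySite κ ∧ IsPeriodicSite κ (N : ℤ) ∧ avgIterS s₂ k U = gaugeAct κ (avgIterS s₁ k U)) ↔
      ∀ U ∈ C, ∃ c : (Matrix n n ℂ)ˣ, c ∈ unitaryUnits (Matrix n n ℂ) ∧
        (∀ w : List (Letter d), disp w = 0 → hol (avgIterS s₂ k U) 0 w = c * hol (avgIterS s₁ k U) 0 w * c⁻¹) ∧
        (∀ (w : List (Letter d)) (i : Fin d), disp w = (N : ℤ) • e i →
          hol (avgIterS s₂ k U) 0 w = c * hol (avgIterS s₁ k U) 0 w * c⁻¹) :=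
  forall₂_congr fun U hU => exists_unitary_periodic_gauge_iff_hol_conj (hu₁ U hU) (hP₁ U hU) (hu₂ U hU) (hP₂ U hU) 0

/-- **★★ HENCE `SchemeGaugeEquiv` FROM (cov₁), (cov₂) AND CONJUGATE BASED LOOPS** (the sufficient direction, as a constructor; necessity is part 18's
`exists_hol_closed_conj` + the Polyakov words by `hol_conj_of_eq_gaugeAct_polyakov`). [folklore] -/
theorem schemeGaugeEquiv_of_hol_conj
    (hu₁ : ∀ U ∈ C, IsUnitaryCfg (avgIterS s₁ k U)) (hP₁ : ∀ U ∈ C, IsPeriodicCfg (avgIterS s₁ k U) (N : ℤ))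
    (hu₂ : ∀ U ∈ C, IsUnitaryCfg (avgIterS s₂ k U)) (hP₂ : ∀ U ∈ C, IsPeriodicCfg (avgIterS s₂ k U) (N : ℤ))
    (cov₁ : ∀ (κ : Site d → (Matrix n n ℂ)ˣ) (U : Site d → Fin d → (Matrix n n ℂ)ˣ), IsUnitarySite κ → IsPeriodicSite κ (N : ℤ) → U ∈ C →
      avgIterS s₁ k (gaugeAct (fun x : Site d => κ (fun i => x i / (L : ℤ) ^ k)) U) = gaugeAct κ (avgIterS s₁ k U))
    (cov₂ : ∀ (κ : Site d → (Matrix n n ℂ)ˣ) (U : Site d → Fin d → (Matrix n n ℂ)ˣ), IsUnitarySite κ → IsPeriodicSite κ (N : ℤ) → U ∈ C →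
      avgIterS s₂ k (gaugeAct (fun x : Site d => κ (fun i => x i / (L : ℤ) ^ k)) U) = gaugeAct κ (avgIterS s₂ k U))
    (hloops : ∀ U ∈ C, ∃ c : (Matrix n n ℂ)ˣ, c ∈ unitaryUnits (Matrix n n ℂ) ∧
        (∀ w : List (Letter d), disp w = 0 → hol (avgIterS s₂ k U) 0 w = c * hol (avgIterS s₁ k U) 0 w * c⁻¹) ∧
        (∀ (w : List (Letter d)) (i : Fin d), disp w = (N : ℤ) • e i →
          hol (avgIterS s₂ k U) 0 w = c * hol (avgIterS s₁ k U) 0 w * c⁻¹)) :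
    SchemeGaugeEquiv d s₁ s₂ L N k C where
  cov₁ := cov₁
  cov₂ := cov₂
  defect := (defect_iff_hol_conj hu₁ hP₁ hu₂ hP₂).2 hloops

end Unitary

end

end Summit.QuantumFields.YangMills.BalabanUVNodes.N16WilsonLoopsGaugeOrbit
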